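import Literature.AlgebraicGeometry.Frobenioids.ArithmeticFrobenioidThm64ivArithEquivalence
import Literature.AlgebraicGeometry.Frobenioids.MotivatingExamplesSubProofs3
import Literature.NumberTheory.NumberFields.ArithmeticEquivalenceThm1Proofs
import HarnessLib

/-!
# Frobenioids I, Theorem 6.4 (iv), second clause: the base fields are ARITHMETICALLY EQUIVALENT (Perlis), hence
# the printed clause for every `F₁` of degree `≤ 6` (GAP-LEDGER G-L1t3-1 #2, continued)

Mochizuki, *The geometry of Frobenioids I: the general theory*, Kyushu J. Math. **62** (2008) 293–400, §6,
Thm. 6.4 (iv) p. 115 l. 23–29 and proof p. 116 l. 17–35 [cite: MochizukiFrdI2008, Thm. 6.4 (iv) p.115];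
R. Perlis, *On the equation `ζ_K(s) = ζ_{K'}(s)`*, J. Number Theory **9** (1977) 342–360, Thm. 1 and Thm. 3
[cite: Perlis1977, Thm. 3 (p. 355)] — both KERNEL-PROVED in the tree (`Perlis1977_thm1_holds`,
`Perlis1977_thm3_holds`, `Literature/NumberTheory/NumberFields/ArithmeticEquivalence*.lean`).

PROOF-ONLY file (cell abc-iut, layer L1; seat abc-iut-w4-d090 gen 5; 0 definitions). Sequel of
`ArithmeticFrobenioidThm64ivArithEquivalence.lean`: there the Cor. 4.11 (iv) datum of an equivalence
`Ψ : C_{K₁/F₁} ⥲ C_{K₂/F₂}` of THE arithmetic Frobenioids was shown to give, at `B₁ = Spec F₁` / `B₂ = Ψ^Base B₁ = Spec F₂`,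
a bijection of finite places preserving residue characteristics and absolute norms. Here:

* `splittingType_eq_of_finitePlaceEquiv` / `arithmeticallyEquivalent_of_finitePlaceEquiv` — BRIDGE (pure number
  theory): a norm-preserving bijection of finite places between two number fields makes them arithmetically
  equivalent in Perlis' sense (`Literature.NumberTheory.NumberFields.ArithmeticallyEquivalent`: equal splitting
  types at every prime — ramification being invisible to splitting types, no prime is excluded);
* `arith_base_arithmeticallyEquivalent` — hence, from the datum alone, **`ArithmeticallyEquivalent F₁ F₂`**; by
  Perlis' Theorem 1 (`Perlis1977_thm1_holds`) the base fields have the same Dedekind zeta function, degree,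
  discriminant, signature and isomorphic unit groups, and their Galois groups inside any common Galois number field
  are Gassmann equivalent (`arith_base_dedekindZeta_eq`, `arith_base_invariants`, `arith_base_isGassmannEquivalent`);
* `Thm64iv_arith_compat_of_finrank_le_six` — by Perlis' Theorem 3 (`Perlis1977_thm3_holds`: number fields of
  degree `≤ 6` are arithmetically solitary) the «solitary» binder of the prequel is DISCHARGED whenever
  `[F₁ : ℚ] ≤ 6`, so **the printed clause of Thm. 6.4 (iv) holds at the constructions for every base field `F₁` of
  degree `≤ 6`** (Galois or not), and `F₁ ≅ F₂` (`nonempty_baseRingEquiv_arith_of_finrank_le_six`).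
What remains of G-L1t3-1 #2 after this file: base fields `F₁` of degree `≥ 7` that are neither Galois over `ℚ`
nor arithmetically solitary — precisely Perlis' non-solitary territory (Gassmann triples such as
`(PSL₂(𝔽₇), S₄, S₄')`, see the prequel's remark). Nothing here bears on, or takes a side on, [IUTchIII] Cor. 3.12.
-/

noncomputable section

namespace Literature.AlgebraicGeometry.Frobenioids

open CategoryTheory Opposite NumberField IsDedekindDomain Ideal UniqueFactorizationMonoid
open Literature.NumberTheory.NumberFields

/-! ### Bridge: norm-preserving bijections of finite places give equal splitting types -/

section Bridge

variable {L₁ L₂ : Type} [Field L₁] [NumberField L₁] [Field L₂] [NumberField L₂]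

/-- Perlis' splitting type of `p` in `L`, re-indexed by the finite PLACES of `L` over `p`: the multiset of the
inertia degrees `f(𝔭_w | p)`, `w ∣ p`. [cite: Perlis1977, §1 (p. 343)] -/
theorem splittingType_eq_map_placesOver (L : Type) [Field L] [NumberField L] {p : ℕ} (hp : p.Prime) :
    splittingType L p =
      ((placesOver_finite (L := L) p).toFinset.val.map fun w : FinitePlace L => w.maximalIdeal.asIdeal).map
        fun P => P.inertiaDeg ℤ := by
  classical
  haveI : Fact p.Prime := ⟨hp⟩
  have hpb : span {(p : ℤ)} ≠ ⊥ := by simp [hp.ne_zero]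
  haveI : (span {(p : ℤ)}).IsMaximal :=
    ((span_singleton_prime (by exact_mod_cast hp.ne_zero)).mpr (Nat.prime_iff_prime_int.mp hp)).isMaximal hpb
  have hinj : Function.Injective fun w : FinitePlace L => w.maximalIdeal.asIdeal :=
    fun w₁ w₂ h => FinitePlace.maximalIdeal_injective (HeightOneSpectrum.ext h)
  -- the finset of prime factors of `p𝓞 L` is the image of the places over `p`
  have hfin : (normalizedFactors (span {(p : 𝓞 L)})).toFinset =
      (placesOver_finite (L := L) p).toFinset.image fun w : FinitePlace L => w.maximalIdeal.asIdeal := by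
    apply Finset.coe_injective
    rw [Finset.coe_image, Set.Finite.coe_toFinset, image_placesOver_eq hp, IsDedekindDomain.coe_primesOverFinset hpb (𝓞 L)]
    ext P
    rw [Finset.mem_coe, Multiset.mem_toFinset, mem_normalizedFactors_span_iff hp]
    rfl
  rw [splittingType_def, ← Multiset.toFinset_val, hfin, Finset.image_val_of_injOn hinj.injOn]

/-- **Bridge.** A bijection of finite places `π : 𝕍(L₁)^fin ≃ 𝕍(L₂)^fin` preserving absolute norms
`N(𝔭_{π w}) = N(𝔭_w)` preserves the splitting type of every rational prime: `w ∣ p ⟺ π w ∣ p` and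
`p^{f(𝔭_{π w}|p)} = N = p^{f(𝔭_w|p)}`. [cite: Perlis1977, §1 (p. 343)] -/
theorem splittingType_eq_of_finitePlaceEquiv (π : FinitePlace L₁ ≃ FinitePlace L₂)
    (hπ : ∀ w, absNorm (π w).maximalIdeal.asIdeal = absNorm w.maximalIdeal.asIdeal) {p : ℕ} (hp : p.Prime) :
    splittingType L₁ p = splittingType L₂ p := by
  classical
  have hrc : ∀ w, residueChar (π w) = residueChar w := fun w => by
    unfold residueChar
    rw [hπ w]
  -- the places over `p` correspond under `π`
  have hS : (placesOver_finite (L := L₂) p).toFinset = (placesOver_finite (L := L₁) p).toFinset.image π := by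
    ext w₂
    simp only [Set.Finite.mem_toFinset, Finset.mem_image]
    constructor
    · intro h
      refine ⟨π.symm w₂, ?_, π.apply_symm_apply w₂⟩
      have h' : residueChar (π (π.symm w₂)) = p := by rw [π.apply_symm_apply]; exact h
      rw [hrc] at h'
      exact h'
    · rintro ⟨w₁, hw₁, rfl⟩
      change residueChar (π w₁) = p
      rw [hrc]
      exact hw₁
  rw [splittingType_eq_map_placesOver L₁ hp, splittingType_eq_map_placesOver L₂ hp, hS,
    Finset.image_val_of_injOn π.injective.injOn, Multiset.map_map, Multiset.map_map, Multiset.map_map]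
  refine Multiset.map_congr rfl fun w hw => ?_
  -- `f(𝔭_{π w} | p) = f(𝔭_w | p)` from `p^f = N`
  rw [Finset.mem_val, Set.Finite.mem_toFinset] at hw
  have hw' : residueChar (π w) = p := by rw [hrc]; exact hw
  haveI : w.maximalIdeal.asIdeal.IsPrime := w.maximalIdeal.isPrime
  haveI : (π w).maximalIdeal.asIdeal.IsPrime := (π w).maximalIdeal.isPrime
  haveI : w.maximalIdeal.asIdeal.LiesOver (span {(p : ℤ)}) := by
    have h := liesOver_residueChar w
    rw [show residueChar w = p from hw] at h
    exact h
  haveI : (π w).maximalIdeal.asIdeal.LiesOver (span {(p : ℤ)}) := by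
    have h := liesOver_residueChar (π w)
    rw [hw'] at h
    exact h
  apply Nat.pow_right_injective hp.two_le
  change p ^ w.maximalIdeal.asIdeal.inertiaDeg ℤ = p ^ (π w).maximalIdeal.asIdeal.inertiaDeg ℤ
  rw [Ideal.pow_inertiaDeg p, Ideal.pow_inertiaDeg p, hπ w]

/-- **Arithmetic equivalence from a norm-preserving bijection of finite places** (Perlis' condition (b),
`ArithmeticallyEquivalent`, at every prime). [cite: Perlis1977, Thm. 1(b) (p. 345)] -/
theorem arithmeticallyEquivalent_of_finitePlaceEquiv (π : FinitePlace L₁ ≃ FinitePlace L₂)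
    (hπ : ∀ w, absNorm (π w).maximalIdeal.asIdeal = absNorm w.maximalIdeal.asIdeal) :
    ArithmeticallyEquivalent L₁ L₂ :=
  fun _ hp => splittingType_eq_of_finitePlaceEquiv π hπ hp

/-- The same with the norm hypothesis in the cell's `log N` form. [cite: Perlis1977, Thm. 1(b) (p. 345)] -/
theorem arithmeticallyEquivalent_of_finitePlaceEquiv_logNorm (π : FinitePlace L₁ ≃ FinitePlace L₂)
    (hπ : ∀ w, logNorm (π w) = logNorm w) : ArithmeticallyEquivalent L₁ L₂ :=
  arithmeticallyEquivalent_of_finitePlaceEquiv π fun w => absNorm_eq_of_logNorm_eq L₂ L₁ (hπ w)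

/-- **Perlis' Theorem 3 in the cell's vocabulary**: a number field of degree `≤ 6` is isomorphic to any number
field to which it is related by a norm-preserving bijection of finite places (`Perlis1977_thm3_holds`).
[cite: Perlis1977, Thm. 3 (p. 355)] -/
theorem nonempty_ringEquiv_of_finitePlaceEquiv_of_finrank_le_six (hdeg : Module.finrank ℚ L₁ ≤ 6)
    (π : FinitePlace L₁ ≃ FinitePlace L₂) (hπ : ∀ w, logNorm (π w) = logNorm w) : Nonempty (L₁ ≃+* L₂) := by
  obtain ⟨e⟩ := Perlis1977_thm3_holds L₁ L₂ hdeg (arithmeticallyEquivalent_of_finitePlaceEquiv_logNorm π hπ)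
  exact ⟨e.toRingEquiv⟩

end Bridge

/-! ### At the arithmetic Frobenioids: the base fields are arithmetically equivalent -/

section Arith

variable {F₁ : Type} [Field F₁] [NumberField F₁] {K₁ : Type} [Field K₁] [Algebra F₁ K₁] [IsGalois F₁ K₁]
variable {F₂ : Type} [Field F₂] [NumberField F₂] {K₂ : Type} [Field K₂] [Algebra F₂ K₂] [IsGalois F₂ K₂]

omit [IsGalois F₁ K₁] [IsGalois F₂ K₂] in
/-- A ring isomorphism of number fields is a `ℚ`-algebra isomorphism. [folklore] -/
private theorem nonempty_ratAlgEquiv_of_ringEquiv {A B : Type} [Field A] [NumberField A] [Field B] [NumberField B]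
    (e : A ≃+* B) : Nonempty (A ≃ₐ[ℚ] B) :=
  ⟨AlgEquiv.ofRingEquiv (f := e) fun q => (e : A →+* B).map_rat_algebraMap q⟩

/-- **[FrdI] Thm. 6.4 (iv) at the constructions, arbitrary `F₁`: the base fields are ARITHMETICALLY EQUIVALENT.**
For an equivalence `Ψ : C_{K₁/F₁} ⥲ C_{K₂/F₂}` of THE arithmetic Frobenioids with its Cor. 4.11 (iv) datum
`(Ψ^Base, Ψ^Φ = E, η, hdiv)` and `B₁ = Spec F₁` (`ε₁ : B₁.L ≃ₐ[F₁] F₁`): `ArithmeticallyEquivalent F₁ F₂` — every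
rational prime has the same splitting type in `F₁` and in `F₂` (the norm-preserving bijection of places of the
prequel, `arith_exists_base_placeEquiv`, through the bridge). [cite: MochizukiFrdI2008, Thm. 6.4 (iv) p.116] -/
theorem arith_base_arithmeticallyEquivalent (Ψ : arithFrobenioid F₁ K₁ ≌ arithFrobenioid F₂ K₂)
    {ΨBase : FinSubextCat F₁ K₁ ⥤ FinSubextCat F₂ K₂} [ΨBase.IsEquivalence]
    (E : PreFrobenioidData.DivisorMonoidIsoOverBase (arithFrobenioidOps F₁ K₁) (arithFrobenioidOps F₂ K₂) ΨBase)
    (η : Ψ.functor ⋙ (arithFrobenioidOps F₂ K₂).base ≅ (arithFrobenioidOps F₁ K₁).base ⋙ ΨBase)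
    (hdiv : ∀ ⦃A B : arithFrobenioid F₁ K₁⦄ (φ : A ⟶ B),
      (arithFrobenioidOps F₂ K₂).div (Ψ.functor.map φ) =
        (arithFrobenioidOps F₂ K₂).pull (η.hom.app A)
          (E.iso ((arithFrobenioidOps F₁ K₁).base.obj A) ((arithFrobenioidOps F₁ K₁).div φ)))
    (B₁ : FinSubextCat F₁ K₁) (ε₁ : B₁.L ≃ₐ[F₁] F₁) : ArithmeticallyEquivalent F₁ F₂ := by
  obtain ⟨⟨ε₂⟩, π₀, -, hln⟩ := arith_exists_base_placeEquiv Ψ E η hdiv B₁ ε₁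
  obtain ⟨e₁⟩ := nonempty_ratAlgEquiv_of_ringEquiv ε₁.toRingEquiv.symm
  obtain ⟨e₂⟩ := nonempty_ratAlgEquiv_of_ringEquiv ε₂.toRingEquiv
  exact ((ArithmeticallyEquivalent.of_algEquiv e₁).trans
    (arithmeticallyEquivalent_of_finitePlaceEquiv_logNorm π₀ hln)).trans (ArithmeticallyEquivalent.of_algEquiv e₂)

/-- Hence **`ζ_{F₁} = ζ_{F₂}`** (Perlis' Theorem 1 (a) ⟺ (b), kernel-proved `Perlis1977_thm1_holds`).
[cite: Perlis1977, Thm. 1 (p. 345)] -/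
theorem arith_base_dedekindZeta_eq (Ψ : arithFrobenioid F₁ K₁ ≌ arithFrobenioid F₂ K₂)
    {ΨBase : FinSubextCat F₁ K₁ ⥤ FinSubextCat F₂ K₂} [ΨBase.IsEquivalence]
    (E : PreFrobenioidData.DivisorMonoidIsoOverBase (arithFrobenioidOps F₁ K₁) (arithFrobenioidOps F₂ K₂) ΨBase)
    (η : Ψ.functor ⋙ (arithFrobenioidOps F₂ K₂).base ≅ (arithFrobenioidOps F₁ K₁).base ⋙ ΨBase)
    (hdiv : ∀ ⦃A B : arithFrobenioid F₁ K₁⦄ (φ : A ⟶ B),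
      (arithFrobenioidOps F₂ K₂).div (Ψ.functor.map φ) =
        (arithFrobenioidOps F₂ K₂).pull (η.hom.app A)
          (E.iso ((arithFrobenioidOps F₁ K₁).base.obj A) ((arithFrobenioidOps F₁ K₁).div φ)))
    (B₁ : FinSubextCat F₁ K₁) (ε₁ : B₁.L ≃ₐ[F₁] F₁) :
    NumberField.dedekindZeta F₁ = NumberField.dedekindZeta F₂ :=
  (Perlis1977_thm1_holds F₁ F₂).1.2 (arith_base_arithmeticallyEquivalent Ψ E η hdiv B₁ ε₁)

/-- Hence the base fields share degree, discriminant, signature and unit-group structure (Perlis' Theorem 1,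
invariants clause). [cite: Perlis1977, Thm. 1 (pp. 345–347)] -/
theorem arith_base_invariants (Ψ : arithFrobenioid F₁ K₁ ≌ arithFrobenioid F₂ K₂)
    {ΨBase : FinSubextCat F₁ K₁ ⥤ FinSubextCat F₂ K₂} [ΨBase.IsEquivalence]
    (E : PreFrobenioidData.DivisorMonoidIsoOverBase (arithFrobenioidOps F₁ K₁) (arithFrobenioidOps F₂ K₂) ΨBase)
    (η : Ψ.functor ⋙ (arithFrobenioidOps F₂ K₂).base ≅ (arithFrobenioidOps F₁ K₁).base ⋙ ΨBase)
    (hdiv : ∀ ⦃A B : arithFrobenioid F₁ K₁⦄ (φ : A ⟶ B),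
      (arithFrobenioidOps F₂ K₂).div (Ψ.functor.map φ) =
        (arithFrobenioidOps F₂ K₂).pull (η.hom.app A)
          (E.iso ((arithFrobenioidOps F₁ K₁).base.obj A) ((arithFrobenioidOps F₁ K₁).div φ)))
    (B₁ : FinSubextCat F₁ K₁) (ε₁ : B₁.L ≃ₐ[F₁] F₁) :
    Module.finrank ℚ F₁ = Module.finrank ℚ F₂ ∧ NumberField.discr F₁ = NumberField.discr F₂ ∧
      NumberField.InfinitePlace.nrRealPlaces F₁ = NumberField.InfinitePlace.nrRealPlaces F₂ ∧
      NumberField.InfinitePlace.nrComplexPlaces F₁ = NumberField.InfinitePlace.nrComplexPlaces F₂ ∧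
      Nonempty ((𝓞 F₁)ˣ ≃* (𝓞 F₂)ˣ) :=
  (Perlis1977_thm1_holds F₁ F₂).2.2.2 (arith_base_arithmeticallyEquivalent Ψ E η hdiv B₁ ε₁)

/-- Hence, inside ANY common finite Galois number field `N`, the subgroups fixing (the images of) `F₁` and `F₂`
are GASSMANN EQUIVALENT (Perlis' Theorem 1 (b) ⟺ (d)) — the group-theoretic shadow of `F₁ ≅ F₂`, which the
printed clause asserts and which holds iff the two subgroups are moreover conjugate.
[cite: Perlis1977, Thm. 1(d) (p. 345)] -/
theorem arith_base_isGassmannEquivalent (Ψ : arithFrobenioid F₁ K₁ ≌ arithFrobenioid F₂ K₂)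
    {ΨBase : FinSubextCat F₁ K₁ ⥤ FinSubextCat F₂ K₂} [ΨBase.IsEquivalence]
    (E : PreFrobenioidData.DivisorMonoidIsoOverBase (arithFrobenioidOps F₁ K₁) (arithFrobenioidOps F₂ K₂) ΨBase)
    (η : Ψ.functor ⋙ (arithFrobenioidOps F₂ K₂).base ≅ (arithFrobenioidOps F₁ K₁).base ⋙ ΨBase)
    (hdiv : ∀ ⦃A B : arithFrobenioid F₁ K₁⦄ (φ : A ⟶ B),
      (arithFrobenioidOps F₂ K₂).div (Ψ.functor.map φ) =
        (arithFrobenioidOps F₂ K₂).pull (η.hom.app A)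
          (E.iso ((arithFrobenioidOps F₁ K₁).base.obj A) ((arithFrobenioidOps F₁ K₁).div φ)))
    (B₁ : FinSubextCat F₁ K₁) (ε₁ : B₁.L ≃ₐ[F₁] F₁)
    (N : Type) [Field N] [NumberField N] [IsGalois ℚ N] (i : F₁ →ₐ[ℚ] N) (i' : F₂ →ₐ[ℚ] N) :
    IsGassmannEquivalent i.fieldRange.fixingSubgroup i'.fieldRange.fixingSubgroup :=
  ((Perlis1977_thm1_holds F₁ F₂).2.2.1 N i i').1 (arith_base_arithmeticallyEquivalent Ψ E η hdiv B₁ ε₁)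

/-! ### The printed clause for every base field of degree `≤ 6` -/

omit [IsGalois F₁ K₁] [IsGalois F₂ K₂] in
/-- The «solitary» binder of `Thm64iv_arith_compat_of_solitary` HOLDS when `[F₁ : ℚ] ≤ 6` (Perlis' Theorem 3).
[cite: Perlis1977, Thm. 3 (p. 355)] -/
theorem arith_solitary_of_finrank_le_six (hdeg : Module.finrank ℚ F₁ ≤ 6)
    (ΨBase : FinSubextCat F₁ K₁ ⥤ FinSubextCat F₂ K₂) (B₁ : FinSubextCat F₁ K₁) (ε₁ : B₁.L ≃ₐ[F₁] F₁)
    (π₀ : FinitePlace B₁.L ≃ FinitePlace (ΨBase.obj B₁).L) (_hrc : ∀ w, residueChar (π₀ w) = residueChar w)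
    (hln : ∀ w, logNorm (π₀ w) = logNorm w) : Nonempty (B₁.L ≃+* (ΨBase.obj B₁).L) := by
  obtain ⟨e₁⟩ := nonempty_ratAlgEquiv_of_ringEquiv ε₁.toRingEquiv
  have hdeg' : Module.finrank ℚ B₁.L ≤ 6 := by rwa [e₁.toLinearEquiv.finrank_eq]
  exact nonempty_ringEquiv_of_finitePlaceEquiv_of_finrank_le_six hdeg' π₀ hln

/-- **[FrdI] Thm. 6.4 (iv), second clause IN FULL at the constructions, for every base field `F₁` with
`[F₁ : ℚ] ≤ 6`** (Galois or not): for an equivalence `Ψ : C_{K₁/F₁} ⥲ C_{K₂/F₂}` of arithmetic Frobenioids with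
Cor. 4.11 (iv) datum, `B₁ = Spec F₁`, and `X = Spec L₁` with `L₁` Galois over `ℚ`, the field `L₂ := (Ψ^Base X).L` is
isomorphic to `L₁` compatibly with an isomorphism `F₁ ≅ F₂` — Perlis' Theorem 3 discharging the solitary binder.
[cite: MochizukiFrdI2008, Thm. 6.4 (iv) p.115] -/
theorem Thm64iv_arith_compat_of_finrank_le_six (hdeg : Module.finrank ℚ F₁ ≤ 6)
    (Ψ : arithFrobenioid F₁ K₁ ≌ arithFrobenioid F₂ K₂)
    {ΨBase : FinSubextCat F₁ K₁ ⥤ FinSubextCat F₂ K₂} [ΨBase.IsEquivalence]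
    (E : PreFrobenioidData.DivisorMonoidIsoOverBase (arithFrobenioidOps F₁ K₁) (arithFrobenioidOps F₂ K₂) ΨBase)
    (η : Ψ.functor ⋙ (arithFrobenioidOps F₂ K₂).base ≅ (arithFrobenioidOps F₁ K₁).base ⋙ ΨBase)
    (hdiv : ∀ ⦃A B : arithFrobenioid F₁ K₁⦄ (φ : A ⟶ B),
      (arithFrobenioidOps F₂ K₂).div (Ψ.functor.map φ) =
        (arithFrobenioidOps F₂ K₂).pull (η.hom.app A)
          (E.iso ((arithFrobenioidOps F₁ K₁).base.obj A) ((arithFrobenioidOps F₁ K₁).div φ)))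
    (B₁ : FinSubextCat F₁ K₁) (ε₁ : B₁.L ≃ₐ[F₁] F₁) (X : FinSubextCat F₁ K₁) (hX : IsGalois ℚ X.L) :
    ∃ (e : X.L ≃+* (ΨBase.obj X).L) (e₀ : F₁ ≃+* F₂),
      ∀ a : F₁, e (algebraMap F₁ X.L a) = algebraMap F₂ (ΨBase.obj X).L (e₀ a) :=
  Thm64iv_arith_compat_of_solitary Ψ E η hdiv B₁ ε₁ (arith_solitary_of_finrank_le_six hdeg ΨBase B₁ ε₁) X hX

/-- In particular **`F₁ ≅ F₂` whenever `[F₁ : ℚ] ≤ 6`**, from the Cor. 4.11 (iv) datum of an equivalence of the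
arithmetic Frobenioids. [cite: MochizukiFrdI2008, Thm. 6.4 (iv) p.115] -/
theorem nonempty_baseRingEquiv_arith_of_finrank_le_six (hdeg : Module.finrank ℚ F₁ ≤ 6)
    (Ψ : arithFrobenioid F₁ K₁ ≌ arithFrobenioid F₂ K₂)
    {ΨBase : FinSubextCat F₁ K₁ ⥤ FinSubextCat F₂ K₂} [ΨBase.IsEquivalence]
    (E : PreFrobenioidData.DivisorMonoidIsoOverBase (arithFrobenioidOps F₁ K₁) (arithFrobenioidOps F₂ K₂) ΨBase)
    (η : Ψ.functor ⋙ (arithFrobenioidOps F₂ K₂).base ≅ (arithFrobenioidOps F₁ K₁).base ⋙ ΨBase)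
    (hdiv : ∀ ⦃A B : arithFrobenioid F₁ K₁⦄ (φ : A ⟶ B),
      (arithFrobenioidOps F₂ K₂).div (Ψ.functor.map φ) =
        (arithFrobenioidOps F₂ K₂).pull (η.hom.app A)
          (E.iso ((arithFrobenioidOps F₁ K₁).base.obj A) ((arithFrobenioidOps F₁ K₁).div φ)))
    (B₁ : FinSubextCat F₁ K₁) (ε₁ : B₁.L ≃ₐ[F₁] F₁) : Nonempty (F₁ ≃+* F₂) := by
  obtain ⟨e⟩ := Perlis1977_thm3_holds F₁ F₂ hdeg (arith_base_arithmeticallyEquivalent Ψ E η hdiv B₁ ε₁)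
  exact ⟨e.toRingEquiv⟩

end Arith

end Literature.AlgebraicGeometry.Frobenioids

end
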